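/-
HONEST FRAMING: certified error envelopes and provably optimal rounding/accumulation schemes for
low-precision formats under stated cost models; every table by two implementations; no hardware
or vendor claims.
-/
import Mathlib.Tactic.LinearCombination
import Summits.Ventures.CertifiedArithmetic.LowPrec.OptDemotionRoutingTable

/-!
# The demotion law (Theorem T8), part 9d: `TT q` and Conjecture D from a cone-closure certificate

The last abstract link of the kernel route to opt gen 14's C36/C37: once every tree's table lies in
the cone of the certificate's rows (part 9c `tab_inCone`), the rows of kinds `O` and `E` —
`2 BR(o) ≤ (1+ρ) BR(o+β-½) + (1-ρ) BR(o-β)` (`o = 2^(q-1) - β + A + ½`) and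
`2 BR(e) ≤ (1-ρ) BR(e+β) + (1+ρ) BR(e-β+½)` (`e = β + B`), the same `ρ = ρ_β ∈ [0, 1]` on both
sides — add up to opt's two-tree inequality `TT q` (part 8l), because
`(1+ρ) X + (1-ρ) Y ≤ 2 max(X, Y)`.  The presence of these rows (as positive multiples of the
integer functionals built here from the VALUE BRIDGE of part 9c, each evaluation point normalised to
a mantissa and a binade by `normPt`, whose output is CHECKED, not trusted) is the decidable test
`ttCheck`; `TT_of_checks` and `conjectureD_of_checks` (with part 8n `conjectureD_of_TT`) are the
theorems the per-`q` certificate files (parts 9e ff.) instantiate.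
-/

namespace Summit.Ventures.CertifiedArithmetic.LowPrec.Opt

open Literature.ComputerArithmetic.JeannerodRump2018
open Literature.ComputerArithmetic.JeannerodRump2018.SumTree
open Cone

/-! ## Normalising an evaluation point -/

/-- `⌊log₂ n⌋` by structural recursion on a fuel argument. -/
def log2Fuel : ℕ → ℕ → ℕ
  | 0, _ => 0
  | f + 1, n => if n < 2 then 0 else log2Fuel f (n / 2) + 1

/-- A candidate part descriptor `(i, L)` with `x = 2^L (2^(q-1) + i) / 2^q` for a positive `q`-bit
dyadic `x` (budget units).  Its correctness is not proved but CHECKED where used (`ptOK`). -/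
def normPt (q : ℕ) (x : ℚ) : ℕ × ℕ :=
  let n := (2 * x).num.toNat
  let L := log2Fuel n n
  (n * 2 ^ (q - 1) / 2 ^ L - 2 ^ (q - 1), L)

/-- The check that `normPt` found a descriptor of `x`. -/
def ptOK (q : ℕ) (x : ℚ) : Bool := decide (pval q (some (normPt q x)) = x)

/-- The integer functional `c · 2^L · v_i` of the point `x` (`(i, L) = normPt q x`): on the table of
a tree it reads `c · 2^q · BR_t(x)`. -/
def ptVec (q : ℕ) (c : ℤ) (x : ℚ) : List ℤ := unitV (normPt q x).1 (c * 2 ^ (normPt q x).2)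

/-- What `ptVec` reads on a tree's table. -/
theorem dot_ptVec {q : ℕ} {x : ℚ} (hx : ptOK q x = true) (c : ℤ) (t : SumTree) :
    dot (ptVec q c x) (tab q t) = (c : ℚ) * (2 ^ q * treeBRv q t x) := by
  simp only [ptOK, decide_eq_true_eq] at hx
  have h := treeBRv_pval q t (normPt q x).1 (normPt q x).2
  rw [hx] at h
  rw [ptVec, dot_unitV, h]
  push_cast
  field_simp

/-- Three points with integer coefficients. -/
def threeVec (q : ℕ) (c₁ : ℤ) (x₁ : ℚ) (c₂ : ℤ) (x₂ : ℚ) (c₃ : ℤ) (x₃ : ℚ) : List ℤ :=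
  addV (ptVec q c₁ x₁) (addV (ptVec q c₂ x₂) (ptVec q c₃ x₃))

/-- THE THREE-POINT TEST: the points normalise, and some row is a positive multiple of the
three-point functional. -/
def triCheck (q : ℕ) (rows : List (List ℤ)) (c₁ : ℤ) (x₁ : ℚ) (c₂ : ℤ) (x₂ : ℚ) (c₃ : ℤ)
    (x₃ : ℚ) : Bool :=
  ptOK q x₁ && (ptOK q x₂ && (ptOK q x₃ &&
    rows.any fun r => posMultV r (threeVec q c₁ x₁ c₂ x₂ c₃ x₃)))

/-- SOUNDNESS of the three-point test: `c₁ BR_t(x₁) + c₂ BR_t(x₂) + c₃ BR_t(x₃) ≤ 0` for every tree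
whose table is in the cone. -/
theorem triCheck_sound {q : ℕ} {rows : List (List ℤ)} {c₁ c₂ c₃ : ℤ} {x₁ x₂ x₃ : ℚ}
    (h : triCheck q rows c₁ x₁ c₂ x₂ c₃ x₃ = true) {t : SumTree} (ht : InCone rows (tab q t)) :
    (c₁ : ℚ) * treeBRv q t x₁ + (c₂ : ℚ) * treeBRv q t x₂ + (c₃ : ℚ) * treeBRv q t x₃ ≤ 0 := by
  simp only [triCheck, Bool.and_eq_true] at h
  obtain ⟨h1, h2, h3, hany⟩ := h
  obtain ⟨r, hr, hmul⟩ := List.any_eq_true.1 hany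
  have key := dot_nonpos_of_posMultV hmul (ht.2 r hr)
  rw [threeVec, dot_addV, dot_addV, dot_ptVec h1, dot_ptVec h2, dot_ptVec h3] at key
  have h2q : (0 : ℚ) < 2 ^ q := by positivity
  have e : (2 : ℚ) ^ q * ((c₁ : ℚ) * treeBRv q t x₁ + (c₂ : ℚ) * treeBRv q t x₂ +
      (c₃ : ℚ) * treeBRv q t x₃) ≤ (2 : ℚ) ^ q * 0 := by
    rw [mul_zero]; linear_combination key
  exact le_of_mul_le_mul_left e h2q

/-! ## The `O` and `E` rows and the test for `TT q` -/

/-- THE `O`-ROW TEST at level `k` (`β = 2^k`), offset `A`, weight `ρ = ρn/ρd`: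
`2ρd BR(o) - (ρd+ρn) BR(o+β-½) - (ρd-ρn) BR(o-β) ≤ 0` is in the cone, `o = 2^(q-1) - β + A + ½`. -/
def oCheck (q : ℕ) (rows : List (List ℤ)) (ρn ρd k A : ℕ) : Bool :=
  let β : ℚ := (2 : ℚ) ^ k
  let o : ℚ := (2 : ℚ) ^ (q - 1) - β + A + 1 / 2
  triCheck q rows (2 * ρd) o (-(ρd + ρn : ℤ)) (o + β - 1 / 2) (-(ρd - ρn : ℤ)) (o - β)

/-- THE `E`-ROW TEST at level `k`, offset `B`:
`2ρd BR(e) - (ρd-ρn) BR(e+β) - (ρd+ρn) BR(e-β+½) ≤ 0` is in the cone, `e = β + B`. -/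
def eCheck (q : ℕ) (rows : List (List ℤ)) (ρn ρd k B : ℕ) : Bool :=
  let β : ℚ := (2 : ℚ) ^ k
  let e : ℚ := β + B
  triCheck q rows (2 * ρd) e (-(ρd - ρn : ℤ)) (e + β) (-(ρd + ρn : ℤ)) (e - β + 1 / 2)

/-- THE TEST FOR `TT q`: for every level `k ≤ q - 2` a weight `0 ≤ ρn ≤ ρd`, `ρd > 0` (list `rho`,
entry `k`), every `O`-row (`A < 2^k`) and every `E`-row (`B < 2^(q-1) - 2^k`, bit `k` of `B` clear). -/
def ttCheck (q : ℕ) (rows : List (List ℤ)) (rho : List (ℕ × ℕ)) : Bool :=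
  (List.range (q - 1)).all fun k =>
    decide ((rho.getD k (0, 1)).1 ≤ (rho.getD k (0, 1)).2) && (decide (0 < (rho.getD k (0, 1)).2) &&
      ((List.range (2 ^ k)).all (fun A => oCheck q rows (rho.getD k (0, 1)).1 (rho.getD k (0, 1)).2 k A) &&
        (List.range (2 ^ (q - 1) - 2 ^ k)).all fun B =>
          B.testBit k || eCheck q rows (rho.getD k (0, 1)).1 (rho.getD k (0, 1)).2 k B))

/-- Soundness of the `O`-row test. -/
theorem oCheck_sound {q : ℕ} {rows : List (List ℤ)} {ρn ρd k A : ℕ}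
    (h : oCheck q rows ρn ρd k A = true) {t : SumTree} (ht : InCone rows (tab q t)) :
    let β : ℚ := (2 : ℚ) ^ k
    let o : ℚ := (2 : ℚ) ^ (q - 1) - β + A + 1 / 2
    2 * (ρd : ℚ) * treeBRv q t o - ((ρd : ℚ) + ρn) * treeBRv q t (o + β - 1 / 2) -
      ((ρd : ℚ) - ρn) * treeBRv q t (o - β) ≤ 0 := by
  have := triCheck_sound h ht
  push_cast at this
  dsimp only
  linear_combination this

/-- Soundness of the `E`-row test. -/
theorem eCheck_sound {q : ℕ} {rows : List (List ℤ)} {ρn ρd k B : ℕ}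
    (h : eCheck q rows ρn ρd k B = true) {t : SumTree} (ht : InCone rows (tab q t)) :
    let β : ℚ := (2 : ℚ) ^ k
    let e : ℚ := β + B
    2 * (ρd : ℚ) * treeBRv q t e - ((ρd : ℚ) - ρn) * treeBRv q t (e + β) -
      ((ρd : ℚ) + ρn) * treeBRv q t (e - β + 1 / 2) ≤ 0 := by
  have := triCheck_sound h ht
  push_cast at this
  dsimp only
  linear_combination this

/-- The final two-line estimate: `(1+ρ) X + (1-ρ) Y ≤ 2 max(X, Y)`. -/
theorem tt_combine {ρn ρd T1a T2a T3a T1b T2b T3b : ℚ} (hρd : 0 < ρd) (hρ : ρn ≤ ρd) (h0 : 0 ≤ ρn)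
    (kO : 2 * ρd * T1a - (ρd + ρn) * T2a - (ρd - ρn) * T3a ≤ 0)
    (kE : 2 * ρd * T1b - (ρd - ρn) * T2b - (ρd + ρn) * T3b ≤ 0) :
    T1a + T1b ≤ max (T2a + T3b) (T3a + T2b) := by
  have hM1 := le_max_left (T2a + T3b) (T3a + T2b)
  have hM2 := le_max_right (T2a + T3b) (T3a + T2b)
  have h1 : (ρd + ρn) * (T2a + T3b) ≤ (ρd + ρn) * max (T2a + T3b) (T3a + T2b) :=
    mul_le_mul_of_nonneg_left hM1 (by linarith)
  have h2 : (ρd - ρn) * (T3a + T2b) ≤ (ρd - ρn) * max (T2a + T3b) (T3a + T2b) :=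
    mul_le_mul_of_nonneg_left hM2 (by linarith)
  have h3 : 2 * ρd * (T1a + T1b) ≤ 2 * ρd * max (T2a + T3b) (T3a + T2b) := by
    linear_combination kO + kE + h1 + h2
  exact le_of_mul_le_mul_left h3 (by linarith)

/-- **`TT q` FROM A CONE-CLOSURE CERTIFICATE**: if every tree's table is in the cone of `rows` and
`rows` pass `ttCheck`, opt's two-tree inequality holds at precision `q`. -/
theorem TT_of_checks {q : ℕ} {rows : List (List ℤ)} {rho : List (ℕ × ℕ)}
    (htt : ttCheck q rows rho = true) (hall : ∀ t : SumTree, InCone rows (tab q t)) : TT q := by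
  intro a b k A B hk hA hB hbit
  have hk' : k ∈ List.range (q - 1) := List.mem_range.2 (by omega)
  have H := List.all_eq_true.1 htt k hk'
  simp only [Bool.and_eq_true, decide_eq_true_eq] at H
  obtain ⟨hρ, hρd, hO, hE⟩ := H
  have hO' := List.all_eq_true.1 hO A (List.mem_range.2 hA)
  have hBr : B ∈ List.range (2 ^ (q - 1) - 2 ^ k) := List.mem_range.2 (by omega)
  have hE' := List.all_eq_true.1 hE B hBr
  rw [hbit, Bool.false_or] at hE'
  have kO := oCheck_sound hO' (hall a)
  have kE := eCheck_sound hE' (hall b)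
  have hρd' : (0 : ℚ) < (rho.getD k (0, 1)).2 := by exact_mod_cast hρd
  have hρ' : ((rho.getD k (0, 1)).1 : ℚ) ≤ (rho.getD k (0, 1)).2 := by exact_mod_cast hρ
  exact tt_combine hρd' hρ' (Nat.cast_nonneg _) kO kE

/-- **CONJECTURE D FOR EVERY TREE AT PRECISION `q` FROM A CONE-CLOSURE CERTIFICATE** (parts 8n +
9b–9d): valid split data, a passing certificate tree for every row, and the `TT` row test give
`s ≤ Q_t · fl_p(ŝ)` for every summation tree of nonnegative `F(q, emin)` data, every `p ≥ 1`, any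
nearest roundings. -/
theorem conjectureD_of_checks {q : ℕ} (hq : 2 ≤ q) {data : List (List (Part × Part))}
    {rows : List (List ℤ)} {rho : List (ℕ × ℕ)} (hdata : dataValid q data = true)
    (hrows : ∀ r ∈ rows, ∃ c, rowCheck q rows data r c = true) (htt : ttCheck q rows rho = true)
    {p : ℕ} (hp : 1 ≤ p) {emin : ℤ} {fl flp : ℚ → ℚ} (hfl : IsRoundNearest q emin fl)
    (hflp : IsRoundNearest p emin flp) (t : SumTree) (ht : ∀ x ∈ leaves t, IsFloat q emin x ∧ 0 ≤ x) :
    exact t ≤ treeQf (unitRoundoff q) t (unitRoundoff p) * flp (eval fl t) :=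
  conjectureD_of_TT hp hq (TT_of_checks htt (tab_inCone (le_trans (by norm_num) hq) hdata hrows)) hfl
    hflp t ht

/-! ## Assembling the per-row certificate facts -/

/-- "Rows `0, …, n-1` have passing certificate trees." -/
def RowsCovered (q : ℕ) (rows : List (List ℤ)) (data : List (List (Part × Part))) (n : ℕ) : Prop :=
  ∀ k, k < n → ∃ c, rowCheck q rows data (rows.getD k []) c = true

/-- A CHUNK of certificate trees for the rows `n₀, n₀ + 1, …` passes. -/
def chunkCheck (q : ℕ) (rows : List (List ℤ)) (data : List (List (Part × Part))) (n₀ : ℕ)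
    (cs : List CTree) : Bool :=
  (cs.zipIdx n₀).all fun p => rowCheck q rows data (rows.getD p.2 []) p.1

/-- No rows are covered by nothing. -/
theorem rowsCovered_zero (q : ℕ) (rows : List (List ℤ)) (data : List (List (Part × Part))) :
    RowsCovered q rows data 0 := fun _ h => absurd h (Nat.not_lt_zero _)

/-- Extending the covered rows by a passing chunk. -/
theorem RowsCovered.extend {q : ℕ} {rows : List (List ℤ)} {data : List (List (Part × Part))} {n : ℕ}
    (h : RowsCovered q rows data n) {cs : List CTree} (hc : chunkCheck q rows data n cs = true) :
    RowsCovered q rows data (n + cs.length) := by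
  intro k hk
  by_cases hkn : k < n
  · exact h k hkn
  · have hidx : k - n < cs.length := by omega
    have hall := (List.forall_mem_zipIdx
      (p := fun x => rowCheck q rows data (rows.getD x.2 []) x.1 = true)).1
      (List.all_eq_true.1 hc) (k - n) hidx
    have e : n + (k - n) = k := by omega
    simp only [e] at hall
    exact ⟨cs[k - n], hall⟩

/-- All rows covered ⟹ the hypothesis of the closure principle. -/
theorem RowsCovered.all {q : ℕ} {rows : List (List ℤ)} {data : List (List (Part × Part))} {n : ℕ}
    (h : RowsCovered q rows data n) (hn : rows.length = n) :
    ∀ r ∈ rows, ∃ c, rowCheck q rows data r c = true := by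
  intro r hr
  obtain ⟨k, hk, rfl⟩ := List.getElem_of_mem hr
  obtain ⟨c, hc⟩ := h k (hn ▸ hk)
  exact ⟨c, by simpa [List.getD_eq_getElem?_getD, List.getElem?_eq_getElem hk] using hc⟩

end Summit.Ventures.CertifiedArithmetic.LowPrec.Opt
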